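import Summits.KontsevichZagierPeriods.KontsevichZagierPeriods.Theorems.LinRedNormalFormArrangementNormalFormStubRebaseSimpleZeroNestedDiffGap

/-!
# Stub `stub_rebaseSimpleZeroTwo`, part `rebaseSimpleZero_nestedDifferent` (crux
`ArrangementNormalForm`, line `janus-bands`) — brick `NestedDiffInterval`

DECIDABLE sub-cases of the interval normal form `HDiff₁` of the assembly
(`rebaseSimpleZeroTwo_of_intervalGGset`: clean nest `A(y) < tᵢ < tⱼ < B(y)` over the literal
interval `{l < y < u}`, inner letter `cᵢ` constant, outer letter `cⱼ` of slope `λ ≠ 0`, base pole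
`r = ℓ₂.2` outside the open interval), each closed by rational inequalities on the data only:
* `rebaseSimpleZero_nestedDiffA1` — `B ∥ cⱼ` and the wall of the edge expansion of `tᵢ` (the line
  of slope `λ` through `(r, cᵢ)`) strictly below `A` at both ends of the interval, or strictly
  above `B` at both ends (type A with a gap, `RebaseDiff.good_typeA_gap`);
* `rebaseSimpleZero_nestedDiffB1` (registered) — `A` constant and the wall of the edge expansion of
  `tⱼ` (the horizontal line at the height `cⱼ(r)`) strictly below `A`, or strictly above `B` at
  both ends (type B with a gap, `RebaseDiff.good_typeB_gap`).
Together with `rebaseSimpleZero_nestedDiffPar1` (`A` constant and `B ∥ cⱼ`, no condition) these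
are the sub-cases of `HDiff₁` closed by this part; the remaining configurations (a wall entering
the band, neither bound letter-parallel) need a dissection of the nest first.

References: M. Kontsevich, D. Zagier, *Periods* (2001), §1.2, rules (1a), (1b), (2).
-/

noncomputable section

open Set MeasureTheory MvPolynomial
open Literature.NumberTheory.Transcendental Literature.ModelTheory.ExponentialFields

namespace Summit.KontsevichZagierPeriods.ArrangementNormalForm.JanusBands

namespace RebaseDiff

open SeparatePos RebasePos RebaseZero RebaseNest

/-- An affine function on an interval is at least the smaller of its end values. -/
theorem min_ends_le_ev (c : Cf) {l u : ℚ} (hlu : l < u) {y : ℝ} (hl : (l : ℝ) ≤ y) (hu : y ≤ (u : ℝ)) :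
    min (ev c l) (ev c u) ≤ ev c y := by
  have hlu0 : (l : ℝ) < u := by exact_mod_cast hlu
  have hlu' : (0 : ℝ) < u - l := by linarith
  set t : ℝ := (y - l) / (u - l) with ht
  have ht0 : 0 ≤ t := div_nonneg (by linarith) hlu'.le
  have ht1 : t ≤ 1 := (div_le_one hlu').2 (by linarith)
  have hy : y = (1 - t) * l + t * u := by rw [ht]; field_simp; ring
  have key : ev c y = (1 - t) * ev c l + t * ev c u := by simp only [ev, hy]; ring
  rw [key]
  nlinarith [min_le_left (ev c (l : ℝ)) (ev c u), min_le_right (ev c (l : ℝ)) (ev c u)]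

/-- An affine function on an interval is at most the larger of its end values. -/
theorem ev_le_max_ends (c : Cf) {l u : ℚ} (hlu : l < u) {y : ℝ} (hl : (l : ℝ) ≤ y) (hu : y ≤ (u : ℝ)) :
    ev c y ≤ max (ev c l) (ev c u) := by
  have h := min_ends_le_ev (-c) hlu hl hu
  simp only [ev_neg, min_neg_neg, neg_le_neg_iff] at h
  exact h

variable {m : ℕ} {i j : Fin 2}

/-- Reading the interval datum: the clean-nest shape of the domain, membership, and the side of
the pole. -/
theorem interval_read (s : KZ.IntegralRep (0 + 1 + 2)) (lo hi : Fin 2 → Fin 2 ⊕ Cf) (A B : Cf) (l u : ℚ) (r : ℚ)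
    (hij : i ≠ j) (hloi : lo i = Sum.inr A) (hhii : hi i = Sum.inl j) (hloj : lo j = Sum.inl i)
    (hhij : hi j = Sum.inr B) (hpole : r ≤ l ∨ u ≤ r)
    (hdom : s.domain = gDom 0 2 2 ![RebaseZero.mk 1 (-l), RebaseZero.mk (-1) u] lo hi) :
    s.domain = gDom 0 2 2 ![RebaseZero.mk 1 (-l), RebaseZero.mk (-1) u] (nlo i A) (nhi j B) ∧
      (∀ z ∈ s.domain, ((l : ℝ) < yv z ∧ yv z < u) ∧ ev A (yv z) < tv z i ∧ tv z i < tv z j ∧ tv z j < ev B (yv z)) ∧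
      ((∀ y ∈ cell ![RebaseZero.mk 1 (-l), RebaseZero.mk (-1) u], (r : ℝ) < y) ∨
        (∀ y ∈ cell ![RebaseZero.mk 1 (-l), RebaseZero.mk (-1) u], y < (r : ℝ))) := by
  obtain ⟨hlo, hhi⟩ := eq_nlo_nhi hij hloi hhii hloj hhij
  subst hlo hhi
  refine ⟨hdom, fun z hz => ?_, ?_⟩
  · rw [hdom, mem_nDom hij, mem_cell_Ioo] at hz
    exact hz
  · rcases hpole with h | h
    · refine Or.inl fun y hy => ?_
      have h' : (r : ℝ) ≤ l := by exact_mod_cast h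
      exact h'.trans_lt ((mem_cell_Ioo l u y).1 hy).1
    · refine Or.inr fun y hy => ?_
      have h' : (u : ℝ) ≤ r := by exact_mod_cast h
      exact ((mem_cell_Ioo l u y).1 hy).2.trans_le h'

end RebaseDiff

/-- **Sub-case `A₁` of the interval normal form `HDiff₁`, closed** (part
`rebaseSimpleZero_nestedDifferent` of `stub_rebaseSimpleZeroTwo`, line `janus-bands`). In the
binder format of `HDiff₁` (`rebaseSimpleZeroTwo_of_intervalGGset`), if moreover the outer upper
bound is parallel to the outer letter (`B.1 (Fin.last 0) = cj.1 (Fin.last 0)`) and the wall of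
the edge expansion of `tᵢ` — the line `W` of slope `λⱼ` through the point `(r, cᵢ)`,
`W = RebaseDiff.rot ci (cj.1 (Fin.last 0)) ℓ₂.2` — lies strictly below `A` at both ends `l, u`
of the interval or strictly above `B` at both ends (rational inequalities), the representation is
congruent modulo `KZ.relations` to the subgroup generated by `GG 0 2 2`
(`RebaseDiff.good_typeA_gap`). [Kontsevich–Zagier 2001, §1.2, rules (1a), (1b), (2)] -/
theorem rebaseSimpleZero_nestedDiffA1 (m : ℕ) (s : KZ.IntegralRep (0 + 1 + 2)) (L : Fin m → (Fin 0 → ℚ) × ℚ) (e : Fin m → ℕ) (p : MvPolynomial (Fin 0) ℚ) (ℓ₁ ℓ₂ : (Fin 0 → ℚ) × ℚ) (a : Fin 2 → Option ((Fin (0 + 1) → ℚ) × ℚ)) (lo hi : Fin 2 → Fin 2 ⊕ ((Fin (0 + 1) → ℚ) × ℚ)) (i j : Fin 2) (A B ci cj : (Fin (0 + 1) → ℚ) × ℚ) (l u : ℚ) (hij : i ≠ j) (hloi : lo i = Sum.inr A) (hhii : hi i = Sum.inl j) (hloj : lo j = Sum.inl i) (hhij : hi j = Sum.inr B) (hai :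 a i = some ci) (haj : a j = some cj) (hci : ci.1 (Fin.last 0) = 0) (hcj : cj.1 (Fin.last 0) ≠ 0) (hlu : l < u) (hAB : ∀ y : ℝ, (l : ℝ) < y → y < (u : ℝ) → RebaseZero.ev A y < RebaseZero.ev B y) (hpole : ℓ₂.2 ≤ l ∨ u ≤ ℓ₂.2) (hbd : Bornology.IsBounded s.domain) (hdom : s.domain = SeparatePos.gDom 0 2 2 ![RebaseZero.mk 1 (-l), RebaseZero.mk (-1) u] lo hi) (hint : EqOn s.integrand (RebasePos.glit 0 2 p L e ℓ₁ ℓ₂ 0 1 a) s.domain) (hB : B.1 (Fin.last 0) = cj.1 (Fin.last 0)) (hwall : (RebaseZero.ev (RebaseDiff.rot ci (cj.1 (Fin.last 0)) ℓ₂.2) l < RebaseZero.ev A l ∧ RebaseZero.ev (RebaseDiff.rot ci (cj.1 (Fin.last 0)) ℓ₂.2) u < RebaseZero.ev A u) ∨ (RebaseZero.ev B l < RebaseZero.ev (RebaseDiff.rot ci (cj.1 (Fin.last 0)) ℓ₂.2) l ∧ RebaseZero.ev B u < RebaseZero.ev (RebaseDiff.rot ci (cj.1 (Fin.last 0)) ℓ₂.2)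 u)) : ∃ c ∈ AddSubgroup.closure (SeparatePos.GGset 0 2 2), KZ.of s - c ∈ KZ.relations := by
  have _hunused : (∀ y : ℝ, (l : ℝ) < y → y < (u : ℝ) → RebaseZero.ev A y < RebaseZero.ev B y) ∧
      ci.1 (Fin.last 0) = 0 ∧ cj.1 (Fin.last 0) ≠ 0 := ⟨hAB, hci, hcj⟩
  obtain ⟨hdom', hmem, hside⟩ := RebaseDiff.interval_read s lo hi A B l u ℓ₂.2 hij hloi hhii hloj hhij hpole hdom
  set W := RebaseDiff.rot ci (cj.1 (Fin.last 0)) ℓ₂.2 with hW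
  rcases hwall with ⟨h1, h2⟩ | ⟨h1, h2⟩
  · -- the wall below `A`
    set g : ℝ := min (RebaseZero.ev (A - W) l) (RebaseZero.ev (A - W) u) with hg
    have hg0 : 0 < g := by
      rw [hg, RebaseZero.ev_sub, RebaseZero.ev_sub]; exact lt_min (by linarith) (by linarith)
    refine RebaseDiff.good_typeA_gap s hij _ A B L e p ℓ₁ ℓ₂ 0 1 a ci cj hai haj hB rfl rfl hside hbd hdom' hint
      g hg0 fun z hz => ?_
    obtain ⟨⟨hl, hu⟩, hA', -, -⟩ := hmem z hz
    have hmin := RebaseDiff.min_ends_le_ev (A - W) hlu hl.le hu.le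
    rw [← hg] at hmin
    rw [RebaseZero.ev_sub] at hmin
    rw [abs_of_pos (by linarith)]
    linarith
  · -- the wall above `B`
    set g : ℝ := min (RebaseZero.ev (W - B) l) (RebaseZero.ev (W - B) u) with hg
    have hg0 : 0 < g := by
      rw [hg, RebaseZero.ev_sub, RebaseZero.ev_sub]; exact lt_min (by linarith) (by linarith)
    refine RebaseDiff.good_typeA_gap s hij _ A B L e p ℓ₁ ℓ₂ 0 1 a ci cj hai haj hB rfl rfl hside hbd hdom' hint
      g hg0 fun z hz => ?_
    obtain ⟨⟨hl, hu⟩, -, hij', hB'⟩ := hmem z hz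
    have hmin := RebaseDiff.min_ends_le_ev (W - B) hlu hl.le hu.le
    rw [← hg] at hmin
    rw [RebaseZero.ev_sub] at hmin
    rw [abs_of_neg (by linarith)]
    linarith

/-- **Registered part `rebaseSimpleZero_nestedDiffB1` of `rebaseSimpleZero_nestedDifferent` (stub
`stub_rebaseSimpleZeroTwo`, line `janus-bands`): sub-case `B₁` of the interval normal form `HDiff₁`,
closed.** In the binder format of `HDiff₁` (`rebaseSimpleZeroTwo_of_intervalGGset`), if moreover
the inner lower bound is constant (`A.1 (Fin.last 0) = 0`, i.e. parallel to the constant inner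
letter) and the wall of the edge expansion of `tⱼ` — the horizontal line at the height
`h = cⱼ(r)` — lies strictly below `A` (`h < A.2`) or strictly above `B` at both ends `l, u` of the
interval (rational inequalities), the representation is congruent modulo `KZ.relations` to the
subgroup generated by `GG 0 2 2` (`RebaseDiff.good_typeB_gap`). [Kontsevich–Zagier 2001, §1.2,
rules (1a), (1b), (2)] -/
theorem rebaseSimpleZero_nestedDiffB1 (m : ℕ) (s : KZ.IntegralRep (0 + 1 + 2)) (L : Fin m → (Fin 0 → ℚ) × ℚ) (e : Fin m → ℕ) (p : MvPolynomial (Fin 0) ℚ) (ℓ₁ ℓ₂ : (Fin 0 → ℚ) × ℚ) (a : Fin 2 → Option ((Fin (0 + 1) → ℚ) × ℚ)) (lo hi : Fin 2 → Fin 2 ⊕ ((Fin (0 + 1) → ℚ) × ℚ)) (i j : Fin 2) (A B ci cj : (Fin (0 + 1) → ℚ) × ℚ) (l u : ℚ) (hij : i ≠ j) (hloi : lo i = Sum.inr A) (hhii : hi i = Sum.inl j) (hloj : lo j = Sum.inl i) (hhij : hi j = Sum.inr B) (hai : a i = some ci) (haj : a j = some cj) (hci : ci.1 (Fin.last 0)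 = 0) (hcj : cj.1 (Fin.last 0) ≠ 0) (hlu : l < u) (hAB : ∀ y : ℝ, (l : ℝ) < y → y < (u : ℝ) → RebaseZero.ev A y < RebaseZero.ev B y) (hpole : ℓ₂.2 ≤ l ∨ u ≤ ℓ₂.2) (hbd : Bornology.IsBounded s.domain) (hdom : s.domain = SeparatePos.gDom 0 2 2 ![RebaseZero.mk 1 (-l), RebaseZero.mk (-1) u] lo hi) (hint : EqOn s.integrand (RebasePos.glit 0 2 p L e ℓ₁ ℓ₂ 0 1 a) s.domain) (hA0 : A.1 (Fin.last 0) = 0) (hwall : (cj.1 (Fin.last 0) * ℓ₂.2 + cj.2 < A.2) ∨ (RebaseZero.ev B l < cj.1 (Fin.last 0) * ℓ₂.2 + cj.2 ∧ RebaseZero.ev B u < cj.1 (Fin.last 0) * ℓ₂.2 + cj.2)) : ∃ c ∈ AddSubgroup.closure (SeparatePos.GGset 0 2 2), KZ.of s - c ∈ KZ.relations := by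
  have _hunused : (∀ y : ℝ, (l : ℝ) < y → y < (u : ℝ) → RebaseZero.ev A y < RebaseZero.ev B y) ∧
      cj.1 (Fin.last 0) ≠ 0 := ⟨hAB, hcj⟩
  obtain ⟨hdom', hmem, hside⟩ := RebaseDiff.interval_read s lo hi A B l u ℓ₂.2 hij hloi hhii hloj hhij hpole hdom
  have hA : A.1 (Fin.last 0) = ci.1 (Fin.last 0) := by rw [hA0, hci]
  -- the wall is the constant `h = cⱼ(r)`
  set h : ℚ := cj.1 (Fin.last 0) * ℓ₂.2 + cj.2 with hh
  have hWv : ∀ y : ℝ, RebaseZero.ev (RebaseDiff.rot cj (ci.1 (Fin.last 0)) ℓ₂.2) y = h := fun y => by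
    rw [hci, RebaseDiff.rot, RebaseZero.ev_mk, hh]; push_cast; ring
  have hAv : ∀ y : ℝ, RebaseZero.ev A y = A.2 := fun y => by
    rw [RebaseZero.ev, hA0, Rat.cast_zero, zero_mul, zero_add]
  rcases hwall with h1 | ⟨h1, h2⟩
  · -- the wall below `A`
    have hg1 : (h : ℝ) < A.2 := by exact_mod_cast h1
    have hg0 : (0 : ℝ) < A.2 - h := by linarith
    refine RebaseDiff.good_typeB_gap s hij _ A B L e p ℓ₁ ℓ₂ 0 1 a ci cj hai haj hA rfl rfl hside hbd hdom' hint
      _ hg0 fun z hz => ?_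
    obtain ⟨-, hA', hij', -⟩ := hmem z hz
    rw [hAv] at hA'
    rw [hWv, abs_of_pos (by linarith)]
    linarith
  · -- the wall above `B`
    set g : ℝ := min ((h : ℝ) - RebaseZero.ev B l) ((h : ℝ) - RebaseZero.ev B u) with hg
    have hg0 : 0 < g := by
      have h1' : RebaseZero.ev B l < (h : ℝ) := by rw [hh]; exact_mod_cast h1
      have h2' : RebaseZero.ev B u < (h : ℝ) := by rw [hh]; exact_mod_cast h2
      exact lt_min (by linarith) (by linarith)
    refine RebaseDiff.good_typeB_gap s hij _ A B L e p ℓ₁ ℓ₂ 0 1 a ci cj hai haj hA rfl rfl hside hbd hdom' hint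
      g hg0 fun z hz => ?_
    obtain ⟨⟨hl, hu⟩, -, -, hB'⟩ := hmem z hz
    have hmax := RebaseDiff.ev_le_max_ends B hlu hl.le hu.le
    have hgle : g ≤ (h : ℝ) - RebaseZero.ev B (RebaseZero.yv z) := by
      rcases le_total (RebaseZero.ev B (l : ℝ)) (RebaseZero.ev B u) with hc | hc
      · rw [max_eq_right hc] at hmax; exact (min_le_right _ _).trans (by linarith)
      · rw [max_eq_left hc] at hmax; exact (min_le_left _ _).trans (by linarith)
    rw [hWv, abs_of_neg (by linarith)]
    linarith

/-- **The covered sub-cases of the interval normal form `HDiff₁`, in one statement** (part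
`rebaseSimpleZero_nestedDifferent` of `stub_rebaseSimpleZeroTwo`, line `janus-bands`). In the binder
format of `HDiff₁` (`rebaseSimpleZeroTwo_of_intervalGGset`), the representation is congruent modulo
`KZ.relations` to the subgroup generated by `GG 0 2 2` in each of the following DECIDABLE
configurations (`W := RebaseDiff.rot ci (cj.1 (Fin.last 0)) ℓ₂.2` the wall of the expansion of
`tᵢ`, `h := cj.1 (Fin.last 0) * ℓ₂.2 + cj.2` the height of the wall of the expansion of `tⱼ`):
(Par) `A` constant and `B ∥ cⱼ`; (A₁) `B ∥ cⱼ` and `W` strictly below `A` or strictly above `B`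
at both ends of the interval; (B₁) `A` constant and `h < A.2` or `h` strictly above `B` at both
ends. The complement — a wall entering the band with the matching bound not letter-parallel, or
neither bound letter-parallel — is NOT covered by this part. [Kontsevich–Zagier 2001, §1.2] -/
theorem rebaseSimpleZero_nestedDiffCovered1 (m : ℕ) (s : KZ.IntegralRep (0 + 1 + 2)) (L : Fin m → (Fin 0 → ℚ) × ℚ) (e : Fin m → ℕ) (p : MvPolynomial (Fin 0) ℚ) (ℓ₁ ℓ₂ : (Fin 0 → ℚ) × ℚ) (a : Fin 2 → Option ((Fin (0 + 1) → ℚ) × ℚ)) (lo hi : Fin 2 → Fin 2 ⊕ ((Fin (0 + 1) → ℚ) × ℚ)) (i j : Fin 2) (A B ci cj : (Fin (0 + 1) → ℚ) × ℚ) (l u : ℚ) (hij : i ≠ j) (hloi : lo i = Sum.inr A) (hhii : hi i = Sum.inl j) (hloj : lo j = Sum.inl i) (hhij : hi j = Sum.inr B) (hai : a i = some ci) (haj : a j = some cj) (hci : ci.1 (Fin.last 0) = 0) (hcj : cj.1 (Fin.last 0) ≠ 0) (hlu : l < u) (hAB : ∀ y : ℝ, (l : ℝ) < y → y < (u : ℝ)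 → RebaseZero.ev A y < RebaseZero.ev B y) (hpole : ℓ₂.2 ≤ l ∨ u ≤ ℓ₂.2) (hbd : Bornology.IsBounded s.domain) (hdom : s.domain = SeparatePos.gDom 0 2 2 ![RebaseZero.mk 1 (-l), RebaseZero.mk (-1) u] lo hi) (hint : EqOn s.integrand (RebasePos.glit 0 2 p L e ℓ₁ ℓ₂ 0 1 a) s.domain) (hcov : (A.1 (Fin.last 0) = 0 ∧ B.1 (Fin.last 0) = cj.1 (Fin.last 0)) ∨ (B.1 (Fin.last 0) = cj.1 (Fin.last 0) ∧ ((RebaseZero.ev (RebaseDiff.rot ci (cj.1 (Fin.last 0)) ℓ₂.2) l < RebaseZero.ev A l ∧ RebaseZero.ev (RebaseDiff.rot ci (cj.1 (Fin.last 0)) ℓ₂.2) u < RebaseZero.ev A u) ∨ (RebaseZero.ev B l < RebaseZero.ev (RebaseDiff.rot ci (cj.1 (Fin.last 0)) ℓ₂.2) l ∧ RebaseZero.ev B u < RebaseZero.ev (RebaseDiff.rot ci (cj.1 (Fin.last 0)) ℓ₂.2) u))) ∨ (A.1 (Fin.last 0) = 0 ∧ ((cj.1 (Fin.last 0) * ℓ₂.2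 + cj.2 < A.2) ∨ (RebaseZero.ev B l < cj.1 (Fin.last 0) * ℓ₂.2 + cj.2 ∧ RebaseZero.ev B u < cj.1 (Fin.last 0) * ℓ₂.2 + cj.2)))) : ∃ c ∈ AddSubgroup.closure (SeparatePos.GGset 0 2 2), KZ.of s - c ∈ KZ.relations := by
  rcases hcov with ⟨hA0, hB⟩ | ⟨hB, hw⟩ | ⟨hA0, hw⟩
  · exact rebaseSimpleZero_nestedDiffPar1 m s L e p ℓ₁ ℓ₂ a lo hi i j A B ci cj l u hij hloi hhii hloj hhij hai haj hci
      hcj hlu hAB hpole hbd hdom hint hA0 hB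
  · exact rebaseSimpleZero_nestedDiffA1 m s L e p ℓ₁ ℓ₂ a lo hi i j A B ci cj l u hij hloi hhii hloj hhij hai haj hci
      hcj hlu hAB hpole hbd hdom hint hB hw
  · exact rebaseSimpleZero_nestedDiffB1 m s L e p ℓ₁ ℓ₂ a lo hi i j A B ci cj l u hij hloi hhii hloj hhij hai haj hci
      hcj hlu hAB hpole hbd hdom hint hA0 hw

end Summit.KontsevichZagierPeriods.ArrangementNormalForm.JanusBands
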